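/-
Copyright (c) 2026 the pub-hodgecm-mathlib formalisation cell (harness21).  Prover seat hodgecm-mathlib-K2E4-p11 (g9): Track B «K2-LIT»,
hLiu418 = stmt-HodgeConjecture-24832, socket #41 KIND W, organ «Φ6b-ind» (J2) (LEAD F0P6-plan (g14) BATCH #178 (1), KW desk F0P2-p08 (g3)):
THE CAYLEY RECURSION OF THE `h`-LINE JETS (TRACE MOMENTS) OF SHIMURA's ξ ON `Herm₂(ℂ)`, EVERY SIGNATURE — the ★ recursion `xiTwo_cayley_recursion`
differentiated along `h + tΘ`.  THEOREMS ONLY (no `def`, no `instance`, no `notation`, no named-fact hypothesis, no `sorry`).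
-/
import Summits.HodgeConjecture.HodgeConjecture.Theorems.K2LiuHermTwoXiCayleyRecursion           -- ★ FILE 3b (this seat): the recursion at order 0
import Summits.HodgeConjecture.HodgeConjecture.Theorems.K2LiuXiTwoMomentsAsHDerivatives          -- ★ `hasDerivAt_moment`, `eval_traceForm`, `isHermitian_add_real_smul`
import HarnessLib

/-!
# Crux `HLiu418`, ROAD Φ ∕ KIND W organ «Φ6b-ind», (J2): the Cayley recursion of the trace moments `M_e(h; α, β) = ∫ (−2πi·tr(Θx))^e Φ^h_{α,β}`

Cell `hodgecm-mathlib`, crux item hLiu418 = `stmt-HodgeConjecture-24832` (helper lane `--supports … --as helper`, count-neutral), route of record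
`HCCMUnconditional`; squad K2 ∕ K2Liu, road `K2_Liu`, socket #41, KIND W.  Second of the three files paying the jet-continuation letter `hJet` of the
«Φ6b-ind» consumer head `K2LiuKindWArchIndefiniteLetter` at orders `e ≥ 1`.

NOTATION (prose only).  `k_Θ(x) = −2πi·tr(Θx)`, `Φ^h_{α,β}(x) = e(−tr(hx))·det(1−ix)^{−α}det(1+ix)^{−β}` (`xiTwoIntegrand 1 h α β`), and the TRACE MOMENT
`M_e(h; α, β) := ∫ k_Θ(x)^e·Φ^h_{α,β}(x) dx` — the `e`-th real `h`-line derivative `(d∕dt)^e ξ(1, h + tΘ; α, β)|₀` (★ `iteratedDeriv_xiTwo_hLine`),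
absolutely convergent for `re(α+β) > 3 + e`; `c₁(h) := tr(adj(h)·Θ) = (d∕dt) det(h + tΘ)|₀`.
WHAT.  For hermitian `h, Θ` (ANY signature of `h`):
* `hasDerivAt_traceMoment` — `(d∕dt)|₀ M_e(h + tΘ; α, β) = M_{e+1}(h; α, β)` for `re(α+β) > 4 + e` (★ `hasDerivAt_moment`);
* `hasDerivAt_det_hLine`, `hasDerivAt_adjTrace_hLine` — `det(h + tΘ)` is quadratic in `t`: derivative `c₁(h)` at `0`; `c₁(h + tΘ)` has derivative `2 det Θ`;
* **`traceMoment_recursion`** — for every `e : ℕ` and `re(α+β) > 3 + e`: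
  `−4π²·(det h·M_e(α,β) + e·c₁(h)·M_{e−1}(α,β) + e(e−1)·det Θ·M_{e−2}(α,β)) = (α+β−1)(α M_e(α+1,β) + β M_e(α,β+1)) + 4αβ·M_e(α+1,β+1)`
  (indices truncated in `ℕ`; the truncated terms carry the vanishing coefficients `e`, `e(e−1)`).  Induction on `e`: order `0` is ★ `xiTwo_cayley_recursion`
  (`g = 1`); the identity at order `e` holds at every `h + tΘ`, and differentiating it at `t = 0` (product rule, the three derivative lemmas, uniqueness
  of the derivative) gives order `e + 1`;
* `traceMoment_eq_of_det_ne_zero` — the same SOLVED for `M_e(α, β)` when `det h ≠ 0`: the right-hand side involves `M_e` only at `α+β` raised by `1` or `2`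
  and the LOWER moments `M_{e−1}, M_{e−2}` at `(α, β)` — the engine of the continuation (J3).
[Shimura1982, §3 Thm. 3.1, §4 Thm. 4.2] [Shimura1997, §16.4–16.5].
HONEST LABEL.  Count-neutral helper of the K2_Liu road; it pays no socket by itself: `HC_CM` is proved only modulo the 7 printed citations
(2 remaining named inputs: hLiu418 = `stmt-HodgeConjecture-24832`, h413 = `stmt-HodgeConjecture-24833`) until rung 0 closes.

## References
* [Shimura1982] G. Shimura, *Confluent hypergeometric functions on tube domains*, Math. Ann. 260 (1982) 269–302: §3 Thm. 3.1, §4 Thm. 4.2.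
* [Shimura1997] G. Shimura, *Euler Products and Eisenstein Series*, CBMS 93 (1997): §16.4–16.5.
-/

set_option autoImplicit false
-- the mandated namespace repeats the single-problem summit's segment (`HodgeConjecture.HodgeConjecture`)
set_option linter.dupNamespace false

noncomputable section

open scoped Matrix ComplexConjugate ComplexOrder
open Complex Matrix MeasureTheory

namespace Summit.HodgeConjecture.HodgeConjecture.Cruxes.HLiu418.K2LiuHermTwoXiMomentRecursion

open Summit.HodgeConjecture.HodgeConjecture.Cruxes.HLiu418.K2LiuHermTwoGammaDefs
open Summit.HodgeConjecture.HodgeConjecture.Cruxes.HLiu418.K2LiuHermTwoConfluentXiDefs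
open Summit.HodgeConjecture.HodgeConjecture.Cruxes.HLiu418.K2LiuHermTwoXiIntegrandLineDeriv (det_add_smul_fin_two adjugate_add_smul_fin_two)
open Summit.HodgeConjecture.HodgeConjecture.Cruxes.HLiu418.K2LiuHermTwoXiCayleyRecursion (xiTwo_cayley_recursion)
open Summit.HodgeConjecture.HodgeConjecture.Cruxes.HLiu418.K2LiuXiTwoMomentsAsHDerivatives

/-! ## §1 The three derivatives along the `h`-line -/

/-- **`(d∕dt)|₀ M_e(h + tΘ; A, B) = M_{e+1}(h; A, B)`** for hermitian `h, Θ` and `re(A+B) > 4 + e` (★ `hasDerivAt_moment` with the weight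
`(−2πi·tr(Θx))^e`). [cite: Shimura1997, §16.4] -/
theorem hasDerivAt_traceMoment {h Θ : Matrix (Fin 2) (Fin 2) ℂ} (hh : h.IsHermitian) (hΘ : Θ.IsHermitian) (e : ℕ) {A B : ℂ}
    (hAB : 4 + (e : ℝ) < (A + B).re) :
    HasDerivAt (fun t : ℝ => ∫ c : ℝ × ℂ × ℝ, (-(2 * Real.pi * I) * (Θ * hermTwo c).trace) ^ e * xiTwoIntegrand 1 (h + (t : ℂ) • Θ) A B c)
      (∫ c : ℝ × ℂ × ℝ, (-(2 * Real.pi * I) * (Θ * hermTwo c).trace) ^ (e + 1) * xiTwoIntegrand 1 h A B c) 0 := by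
  set L : MvPolynomial (Fin 2 × Fin 2) ℂ :=
    MvPolynomial.C (-(2 * Real.pi * I)) * ∑ jk : Fin 2 × Fin 2, MvPolynomial.C (Θ jk.2 jk.1) * MvPolynomial.X jk with hL
  have hLeval : ∀ c : ℝ × ℂ × ℝ, MvPolynomial.eval (fun jk : Fin 2 × Fin 2 => hermTwo c jk.1 jk.2) (L ^ e) = (-(2 * Real.pi * I) * (Θ * hermTwo c).trace) ^ e :=
    fun c => by rw [map_pow, hL, eval_traceForm Θ c]
  have hdeg : ((L ^ e).totalDegree : ℝ) ≤ e := by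
    have h1 : (L ^ e).totalDegree ≤ e * 1 :=
      (MvPolynomial.totalDegree_pow _ _).trans (Nat.mul_le_mul_left _ (by rw [hL]; exact totalDegree_traceForm_le Θ))
    rw [mul_one] at h1
    exact_mod_cast h1
  have h0 := hasDerivAt_moment (L ^ e) hh hΘ (A := A) (B := B) (by linarith) 0
  have hf : (fun t : ℝ => ∫ c : ℝ × ℂ × ℝ, MvPolynomial.eval (fun jk : Fin 2 × Fin 2 => hermTwo c jk.1 jk.2) (L ^ e) *
      xiTwoIntegrand 1 (h + (t : ℂ) • Θ) A B c) =
      fun t : ℝ => ∫ c : ℝ × ℂ × ℝ, (-(2 * Real.pi * I) * (Θ * hermTwo c).trace) ^ e * xiTwoIntegrand 1 (h + (t : ℂ) • Θ) A B c := by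
    funext t
    simp only [hLeval]
  rw [hf] at h0
  refine h0.congr_deriv (integral_congr_ae (Filter.Eventually.of_forall fun c => ?_))
  simp only [hLeval, ofReal_zero, zero_smul, add_zero, pow_succ]

/-- `tr(adj(Θ)·Θ) = 2·det Θ` (`2 × 2`). [folklore] -/
theorem trace_adjugate_mul_self (Θ : Matrix (Fin 2) (Fin 2) ℂ) : (Θ.adjugate * Θ).trace = 2 * Θ.det := by
  rw [Matrix.adjugate_mul, Matrix.trace_smul, Matrix.trace_one, Fintype.card_fin, smul_eq_mul]
  push_cast
  ring

/-- **`(d∕dt)|₀ det(h + tΘ) = tr(adj(h)·Θ)`** (`det(h + tΘ) = det h + t·tr(adj(h)Θ) + t²·det Θ`). [folklore] -/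
theorem hasDerivAt_det_hLine (h Θ : Matrix (Fin 2) (Fin 2) ℂ) :
    HasDerivAt (fun t : ℝ => (h + (t : ℂ) • Θ).det) ((h.adjugate * Θ).trace) 0 := by
  have h1 : HasDerivAt (fun t : ℝ => (t : ℂ)) 1 0 := by simpa using (hasDerivAt_id' (0 : ℝ)).ofReal_comp   -- (★ `LefschetzBase.hasDerivAt_ofReal'`)
  have h2 : HasDerivAt (fun t : ℝ => h.det + (t : ℂ) * (h.adjugate * Θ).trace + (t : ℂ) ^ 2 * Θ.det)
      (1 * (h.adjugate * Θ).trace + ((2 : ℕ) * ((0 : ℝ) : ℂ) ^ (2 - 1) * 1) * Θ.det) 0 :=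
    ((h1.mul_const ((h.adjugate * Θ).trace)).const_add h.det).fun_add ((h1.fun_pow 2).mul_const Θ.det)
  have hf : (fun t : ℝ => (h + (t : ℂ) • Θ).det) = fun t : ℝ => h.det + (t : ℂ) * (h.adjugate * Θ).trace + (t : ℂ) ^ 2 * Θ.det :=
    funext fun t => det_add_smul_fin_two h Θ (t : ℂ)
  rw [hf]
  exact h2.congr_deriv (by simp)

/-- **`(d∕dt)|₀ tr(adj(h + tΘ)·Θ) = 2·det Θ`** (`adj` is linear on `2 × 2` matrices). [folklore] -/
theorem hasDerivAt_adjTrace_hLine (h Θ : Matrix (Fin 2) (Fin 2) ℂ) :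
    HasDerivAt (fun t : ℝ => ((h + (t : ℂ) • Θ).adjugate * Θ).trace) (2 * Θ.det) 0 := by
  have h1 : HasDerivAt (fun t : ℝ => (t : ℂ)) 1 0 := by simpa using (hasDerivAt_id' (0 : ℝ)).ofReal_comp   -- (★ `LefschetzBase.hasDerivAt_ofReal'`)
  have hf : (fun t : ℝ => ((h + (t : ℂ) • Θ).adjugate * Θ).trace) = fun t : ℝ => (h.adjugate * Θ).trace + (t : ℂ) * (2 * Θ.det) := by
    funext t
    rw [adjugate_add_smul_fin_two, Matrix.add_mul, Matrix.smul_mul, Matrix.trace_add, Matrix.trace_smul, smul_eq_mul,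
      trace_adjugate_mul_self]
  rw [hf]
  simpa using (h1.mul_const (2 * Θ.det)).const_add ((h.adjugate * Θ).trace)

/-! ## §2 The recursion of the trace moments, every order -/

/-- **THE CAYLEY RECURSION OF THE TRACE MOMENTS, EVERY ORDER AND EVERY SIGNATURE** (organ «Φ6b-ind» (J2)): for hermitian `Θ`, `e : ℕ`, hermitian `h`
and `re(α+β) > 3 + e`,
  `−4π²·(det h·M_e(h;α,β) + e·tr(adj(h)Θ)·M_{e−1}(h;α,β) + e(e−1)·det Θ·M_{e−2}(h;α,β))`
  `   = (α+β−1)·(α·M_e(h;α+1,β) + β·M_e(h;α,β+1)) + 4αβ·M_e(h;α+1,β+1)`,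
`M_e(h;α,β) = ∫ (−2πi·tr(Θx))^e·ξ-integrand(1, h; α, β)(x) dx` (indices truncated in `ℕ`, killed by the coefficients `e`, `e(e−1)`).  Order `0` is ★
`xiTwo_cayley_recursion` at `g = 1`; order `e + 1` is order `e` along `h + tΘ` differentiated at `t = 0`. [cite: Shimura1982, §3 Thm. 3.1] [cite: Shimura1997, §16.4–16.5] -/
theorem traceMoment_recursion {Θ : Matrix (Fin 2) (Fin 2) ℂ} (hΘ : Θ.IsHermitian) (e : ℕ) :
    ∀ {h : Matrix (Fin 2) (Fin 2) ℂ}, h.IsHermitian → ∀ {α β : ℂ}, 3 + (e : ℝ) < (α + β).re →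
      -(4 * (Real.pi : ℂ) ^ 2) *
          (h.det * (∫ c : ℝ × ℂ × ℝ, (-(2 * Real.pi * I) * (Θ * hermTwo c).trace) ^ e * xiTwoIntegrand 1 h α β c) +
            (e : ℂ) * (h.adjugate * Θ).trace * (∫ c : ℝ × ℂ × ℝ, (-(2 * Real.pi * I) * (Θ * hermTwo c).trace) ^ (e - 1) * xiTwoIntegrand 1 h α β c) +
            (e : ℂ) * ((e : ℂ) - 1) * Θ.det * (∫ c : ℝ × ℂ × ℝ, (-(2 * Real.pi * I) * (Θ * hermTwo c).trace) ^ (e - 2) * xiTwoIntegrand 1 h α β c)) =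
        (α + β - 1) * (α * (∫ c : ℝ × ℂ × ℝ, (-(2 * Real.pi * I) * (Θ * hermTwo c).trace) ^ e * xiTwoIntegrand 1 h (α + 1) β c) +
            β * (∫ c : ℝ × ℂ × ℝ, (-(2 * Real.pi * I) * (Θ * hermTwo c).trace) ^ e * xiTwoIntegrand 1 h α (β + 1) c)) +
          4 * α * β * (∫ c : ℝ × ℂ × ℝ, (-(2 * Real.pi * I) * (Θ * hermTwo c).trace) ^ e * xiTwoIntegrand 1 h (α + 1) (β + 1) c) := by
  induction e with
  | zero =>
    intro h hh α β hαβ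
    have hαβ' : 3 < (α + β).re := by simpa using hαβ
    have h0 := xiTwo_cayley_recursion Matrix.PosDef.one hh hαβ'
    simp only [xiTwo_def, Matrix.det_one, mul_one] at h0
    simp only [pow_zero, one_mul, Nat.cast_zero, zero_mul, add_zero]
    linear_combination h0
  | succ e ih =>
    intro h hh α β hαβ
    have he : 4 + (e : ℝ) < (α + β).re := by push_cast at hαβ; linarith
    have he1 : 4 + ((e - 1 : ℕ) : ℝ) < (α + β).re := lt_of_le_of_lt (by gcongr; exact Nat.sub_le e 1) he
    have he2 : 4 + ((e - 2 : ℕ) : ℝ) < (α + β).re := lt_of_le_of_lt (by gcongr; exact Nat.sub_le e 2) he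
    have he10 : 4 + (e : ℝ) < (α + 1 + β).re := by simp only [add_re, one_re] at he ⊢; linarith
    have he01 : 4 + (e : ℝ) < (α + (β + 1)).re := by simp only [add_re, one_re] at he ⊢; linarith
    have he11 : 4 + (e : ℝ) < (α + 1 + (β + 1)).re := by simp only [add_re, one_re] at he ⊢; linarith
    have hcond : 3 + (e : ℝ) < (α + β).re := by linarith
    -- the derivatives at `t = 0` of every term of the order-`e` identity along `h + tΘ`
    have hD := hasDerivAt_det_hLine h Θ
    have hC := hasDerivAt_adjTrace_hLine h Θ
    have hMe := hasDerivAt_traceMoment hh hΘ e he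
    have hMe1 := hasDerivAt_traceMoment hh hΘ (e - 1) he1
    have hMe2 := hasDerivAt_traceMoment hh hΘ (e - 2) he2
    have hM10 := hasDerivAt_traceMoment hh hΘ e he10
    have hM01 := hasDerivAt_traceMoment hh hΘ e he01
    have hM11 := hasDerivAt_traceMoment hh hΘ e he11
    have hφ := (((hD.fun_mul hMe).fun_add ((hC.const_mul (e : ℂ)).fun_mul hMe1)).fun_add
      (hMe2.const_mul ((e : ℂ) * ((e : ℂ) - 1) * Θ.det))).const_mul (-(4 * (Real.pi : ℂ) ^ 2))
    have hψ := (((hM10.const_mul α).fun_add (hM01.const_mul β)).const_mul (α + β - 1)).fun_add (hM11.const_mul (4 * α * β))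
    -- the order-`e` identity holds all along the line, so the two derivatives agree
    have key := hφ.unique (hψ.congr_of_eventuallyEq (Filter.Eventually.of_forall fun t : ℝ =>
      ih (isHermitian_add_real_smul hh hΘ t) hcond))
    simp only [ofReal_zero, zero_smul, add_zero] at key
    -- bookkeeping of the truncated indices and of the coefficients
    rcases e with _ | _ | e
    · norm_num at key ⊢
      linear_combination key
    · norm_num at key ⊢
      linear_combination key
    · have i1 : e + 1 + 1 + 1 - 1 = e + 1 + 1 := by omega
      have i2 : e + 1 + 1 + 1 - 2 = e + 1 := by omega
      have i3 : e + 1 + 1 - 1 + 1 = e + 1 + 1 := by omega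
      have i4 : e + 1 + 1 - 2 + 1 = e + 1 := by omega
      have i5 : e + 1 + 1 - 1 = e + 1 := by omega
      rw [i1, i2]
      rw [i3, i4, i5] at key
      push_cast at key ⊢
      linear_combination key

/-! ## §3 The recursion solved for `M_e(α, β)` at a non-degenerate `h` -/

/-- `−4π² ≠ 0` in `ℂ`. [folklore] -/
theorem neg_four_pi_sq_ne_zero : (-(4 * (Real.pi : ℂ) ^ 2)) ≠ 0 :=
  neg_ne_zero.mpr (mul_ne_zero (by norm_num) (pow_ne_zero _ (ofReal_ne_zero.mpr Real.pi_ne_zero)))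

/-- **THE TRACE-MOMENT RECURSION SOLVED FOR `M_e(h; α, β)`** at `det h ≠ 0` (hermitian `h, Θ`, `re(α+β) > 3 + e`):
`M_e(α,β) = (−4π² det h)⁻¹·((α+β−1)(α M_e(α+1,β) + β M_e(α,β+1)) + 4αβ M_e(α+1,β+1)) − (det h)⁻¹·(e·tr(adj(h)Θ)·M_{e−1}(α,β) + e(e−1)·det Θ·M_{e−2}(α,β))`
— the right-hand side sees `M_e` only at `α+β` raised by `1` or `2`, and lower moments. [cite: Shimura1982, §3 Thm. 3.1, §4 Thm. 4.2] -/
theorem traceMoment_eq_of_det_ne_zero {Θ : Matrix (Fin 2) (Fin 2) ℂ} (hΘ : Θ.IsHermitian) (e : ℕ) {h : Matrix (Fin 2) (Fin 2) ℂ}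
    (hh : h.IsHermitian) (hdet : h.det ≠ 0) {α β : ℂ} (hαβ : 3 + (e : ℝ) < (α + β).re) :
    (∫ c : ℝ × ℂ × ℝ, (-(2 * Real.pi * I) * (Θ * hermTwo c).trace) ^ e * xiTwoIntegrand 1 h α β c) =
      (-(4 * (Real.pi : ℂ) ^ 2) * h.det)⁻¹ *
          ((α + β - 1) * (α * (∫ c : ℝ × ℂ × ℝ, (-(2 * Real.pi * I) * (Θ * hermTwo c).trace) ^ e * xiTwoIntegrand 1 h (α + 1) β c) +
              β * (∫ c : ℝ × ℂ × ℝ, (-(2 * Real.pi * I) * (Θ * hermTwo c).trace) ^ e * xiTwoIntegrand 1 h α (β + 1) c)) +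
            4 * α * β * (∫ c : ℝ × ℂ × ℝ, (-(2 * Real.pi * I) * (Θ * hermTwo c).trace) ^ e * xiTwoIntegrand 1 h (α + 1) (β + 1) c)) -
        (h.det)⁻¹ * ((e : ℂ) * (h.adjugate * Θ).trace *
            (∫ c : ℝ × ℂ × ℝ, (-(2 * Real.pi * I) * (Θ * hermTwo c).trace) ^ (e - 1) * xiTwoIntegrand 1 h α β c) +
          (e : ℂ) * ((e : ℂ) - 1) * Θ.det * (∫ c : ℝ × ℂ × ℝ, (-(2 * Real.pi * I) * (Θ * hermTwo c).trace) ^ (e - 2) * xiTwoIntegrand 1 h α β c)) := by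
  have hrec := traceMoment_recursion hΘ e hh hαβ
  have hK := neg_four_pi_sq_ne_zero
  rw [eq_sub_iff_add_eq, eq_inv_mul_iff_mul_eq₀ (mul_ne_zero hK hdet), ← hrec]
  field_simp
  ring

end Summit.HodgeConjecture.HodgeConjecture.Cruxes.HLiu418.K2LiuHermTwoXiMomentRecursion

end
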